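import Literature.Computability.QuantumComplexity.ExactCompilerLevelCorrect
import HarnessLib

/-!
# The exact braid compiler: the schedule and the end-to-end guarantee

Topic `Literature/Computability/QuantumComplexity`; sequel of `ExactCompilerLevelCorrect.lean`.
We fix the schedule the reduction machine uses and prove the compiler correct (Aharonov–Arad 2011
§3.3, with our exact greedy scheme in place of Solovay–Kitaev):

* scales `e_t = 1/(200 · 4^t)`: level `t+1` runs `levelStep` with `(p, q) = (1, 200 · 4^t)` and a
  uniform `Jmax = 50^(2^S) + 2` (`schedule L S`);
* tower bounds (`chord_towerLast_le`, `le_chord_towerLast`): from `r_{s+1} ∈ [r_s²/2, 2r_s²]`,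
  `2 (r₀/2)^(2^s) ≤ r_s ≤ (2 r₀)^(2^s) / 2`; with `r₀ ∈ [1/25, 3/50]` every tower angle is at least
  `2 · 50^{-2^S}` (so `Jmax` is adequate) and the deepest one is at most `(π/4)(3/25)^(2^S)` (so it
  passes `smallTest` at every scale once `(π/4)(3/25)^(2^S) ≤ e_{L-1}/32`, hypothesis `hS`);
* `norm_sub_initW_le` — the best net element is within `1/200`;
* **`norm_sub_compile_le`** — `‖T - ev (compile net c₀ S score (schedule L S))‖ ≤ 1/(200 · 4^L)`.

## References

* D. Aharonov, I. Arad, New J. Phys. 13 (2011) 035019, §3.3 [AharonovArad2011].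
* C. M. Dawson, M. A. Nielsen, QIC 6 (2006), §3 [DawsonNielsen2006].
-/

noncomputable section

open scoped Matrix.Norms.L2Operator

namespace Literature.Computability.QuantumComplexity

open Matrix Complex QuadraticAlgebra

local notation "SU2" => Matrix.specialUnitaryGroup (Fin 2) ℂ
local notation "M2" => Matrix (Fin 2) (Fin 2) ℂ

namespace ExactCompiler

variable {Γ : Type} (E : EvalSpec Γ)

/-! ### The schedule -/

/-- **The schedule**: level `t + 1` (for `t < L`) has scale `e_t = 1/(200·4^t)` and `Jmax = 50^(2^S) + 2`.
[cite: AharonovArad2011, §3.3] -/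
def schedule (L S : ℕ) : List (ℕ × ℕ × ℕ) := (List.range L).map fun t => (1, 200 * 4 ^ t, 50 ^ (2 ^ S) + 2)

/-- `descend` along `range (t+1)` is one more `levelStep`. [folklore] -/
theorem descend_range_succ (net towerL : List (Cand Γ)) (score : Matrix (Fin 2) (Fin 2) K5 → ZPhiS)
    (f : ℕ → ℕ × ℕ × ℕ) (W₀ : Cand Γ) (t : ℕ) :
    descend net towerL score ((List.range (t + 1)).map f) W₀ =
      levelStep net towerL score (f t).1 (f t).2.1 (f t).2.2 (descend net towerL score ((List.range t).map f) W₀) := by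
  rw [descend, descend, List.range_succ, List.map_append, List.foldl_append]; rfl

/-- `descend` is well formed. [folklore] -/
theorem wf_descend {net : List (Cand Γ)} (hnet : AllWF E net) {towerL : List (Cand Γ)} (htower : AllWF E towerL)
    (score : Matrix (Fin 2) (Fin 2) K5 → ZPhiS) (f : ℕ → ℕ × ℕ × ℕ) {W₀ : Cand Γ} (hW₀ : W₀.WF E.mat₀) :
    ∀ t, (descend net towerL score ((List.range t).map f) W₀).WF E.mat₀
  | 0 => by simpa [descend] using hW₀
  | t + 1 => by rw [descend_range_succ]; exact wf_levelStep E hnet htower score _ _ _ (wf_descend hnet htower score f hW₀ t)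

/-! ### Quantitative tower bounds -/

/-- **Upper bound**: `r_s ≤ (2 r₀)^(2^s) / 2`. [cite: DawsonNielsen2006, §4.1] -/
theorem chord_towerLast_le {net : List (Cand Γ)} (hnet : IsNet E net) (hne : net ≠ []) {c₀ : Cand Γ}
    (hc₀ : c₀.WF E.mat₀) (hr₀ : chord E c₀ hc₀ ≤ 1 / 2) :
    ∀ s, chord E (towerLast net c₀ s) (wf_towerLast E hnet.1 hc₀ s) ≤ (2 * chord E c₀ hc₀) ^ (2 ^ s) / 2
  | 0 => by rw [chord_congr E (wf_towerLast E hnet.1 hc₀ 0) hc₀ (by rw [towerLast_zero])]; simp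
  | s + 1 => by
    obtain ⟨_, _, hhi⟩ := chord_towerLast_succ E hnet hne hc₀ hr₀ s
    have ih := chord_towerLast_le hnet hne hc₀ hr₀ s
    have h0 : 0 ≤ chord E (towerLast net c₀ s) (wf_towerLast E hnet.1 hc₀ s) := norm_nonneg _
    calc chord E (towerLast net c₀ (s + 1)) (wf_towerLast E hnet.1 hc₀ (s + 1))
        ≤ 2 * chord E (towerLast net c₀ s) (wf_towerLast E hnet.1 hc₀ s) ^ 2 := hhi
      _ ≤ 2 * ((2 * chord E c₀ hc₀) ^ (2 ^ s) / 2) ^ 2 := by gcongr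
      _ = (2 * chord E c₀ hc₀) ^ (2 ^ (s + 1)) / 2 := by
          rw [show 2 ^ (s + 1) = 2 ^ s * 2 from pow_succ 2 s, pow_mul]; ring

/-- **Lower bound**: `2 (r₀/2)^(2^s) ≤ r_s`. [cite: DawsonNielsen2006, §4.1] -/
theorem le_chord_towerLast {net : List (Cand Γ)} (hnet : IsNet E net) (hne : net ≠ []) {c₀ : Cand Γ}
    (hc₀ : c₀.WF E.mat₀) (hr₀ : chord E c₀ hc₀ ≤ 1 / 2) :
    ∀ s, 2 * (chord E c₀ hc₀ / 2) ^ (2 ^ s) ≤ chord E (towerLast net c₀ s) (wf_towerLast E hnet.1 hc₀ s)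
  | 0 => by rw [chord_congr E (wf_towerLast E hnet.1 hc₀ 0) hc₀ (by rw [towerLast_zero]), pow_zero, pow_one]; linarith
  | s + 1 => by
    obtain ⟨_, hlo, _⟩ := chord_towerLast_succ E hnet hne hc₀ hr₀ s
    have ih := le_chord_towerLast hnet hne hc₀ hr₀ s
    have h0 : 0 ≤ 2 * (chord E c₀ hc₀ / 2) ^ (2 ^ s) := by have := norm_nonneg ((1 : M2) - ((evS E c₀ hc₀ : SU2) : M2)); positivity
    calc 2 * (chord E c₀ hc₀ / 2) ^ (2 ^ (s + 1)) = (2 * (chord E c₀ hc₀ / 2) ^ (2 ^ s)) ^ 2 / 2 := by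
          rw [show 2 ^ (s + 1) = 2 ^ s * 2 from pow_succ 2 s, pow_mul]; ring
      _ ≤ chord E (towerLast net c₀ s) (wf_towerLast E hnet.1 hc₀ s) ^ 2 / 2 := by gcongr
      _ ≤ chord E (towerLast net c₀ (s + 1)) (wf_towerLast E hnet.1 hc₀ (s + 1)) := hlo

/-- **Angles along the tower**: positive, at most `π/4`, uniformly bounded below by `2·50^{-2^S}` and
the deepest at most `(π/4)(3/25)^(2^S)`, when `r₀ ∈ [1/25, 3/50]`. [cite: AharonovArad2011, §3.3] -/
theorem ang_tower_bounds {net : List (Cand Γ)} (hnet : IsNet E net) (hne : net ≠ []) {c₀ : Cand Γ}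
    (hc₀ : c₀.WF E.mat₀) (hlo₀ : 1 / 25 ≤ chord E c₀ hc₀) (hhi₀ : chord E c₀ hc₀ ≤ 3 / 50) (S : ℕ) :
    (∀ c ∈ tower net c₀ S, ∀ hc : c.WF E.mat₀,
        0 < ang (evS E c hc) ∧ ang (evS E c hc) ≤ Real.pi / 2 ∧ 2 * (1 / 50 : ℝ) ^ (2 ^ S) ≤ ang (evS E c hc)) ∧
      ang (evS E (towerLast net c₀ S) (wf_towerLast E hnet.1 hc₀ S)) ≤ Real.pi / 4 * (3 / 25 : ℝ) ^ (2 ^ S) := by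
  have hr₀ : chord E c₀ hc₀ ≤ 1 / 2 := by linarith
  have hpos₀ : 0 < chord E c₀ hc₀ := by linarith
  refine ⟨fun c hcm hc => ?_, ?_⟩
  · obtain ⟨s, hs, rfl⟩ := (mem_tower_iff net c₀ S c).1 hcm
    have hlow := le_chord_towerLast E hnet hne hc₀ hr₀ s
    obtain ⟨hp, hle⟩ := chord_towerLast_pos E hnet hne hc₀ hr₀ hpos₀ s
    have e : chord E (towerLast net c₀ s) (wf_towerLast E hnet.1 hc₀ s) = chord E (towerLast net c₀ s) hc := rfl
    have h1 : chord E (towerLast net c₀ s) hc ≤ ang (evS E (towerLast net c₀ s) hc) := norm_one_sub_le_ang _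
    have h2 := ang_le_mul_norm_one_sub (evS E (towerLast net c₀ s) hc)
    change ang _ ≤ Real.pi / 2 * chord E (towerLast net c₀ s) hc at h2
    rw [e] at hlow hp hle
    refine ⟨by linarith, ?_, ?_⟩
    · have hpi := Real.pi_pos; nlinarith
    · -- `2 (1/50)^(2^S) ≤ 2 (r₀/2)^(2^S) ≤ 2 (r₀/2)^(2^s) ≤ r_s ≤ ang`
      have h3 : (1 / 50 : ℝ) ^ (2 ^ S) ≤ (chord E c₀ hc₀ / 2) ^ (2 ^ S) := pow_le_pow_left₀ (by norm_num) (by linarith) _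
      have h4 : (chord E c₀ hc₀ / 2) ^ (2 ^ S) ≤ (chord E c₀ hc₀ / 2) ^ (2 ^ s) :=
        pow_le_pow_of_le_one (by linarith) (by linarith) (Nat.pow_le_pow_right (by norm_num) hs)
      linarith
  · have hup := chord_towerLast_le E hnet hne hc₀ hr₀ S
    have h2 := ang_le_mul_norm_one_sub (evS E (towerLast net c₀ S) (wf_towerLast E hnet.1 hc₀ S))
    change ang _ ≤ Real.pi / 2 * chord E (towerLast net c₀ S) (wf_towerLast E hnet.1 hc₀ S) at h2
    have h3 : (2 * chord E c₀ hc₀) ^ (2 ^ S) ≤ (3 / 25 : ℝ) ^ (2 ^ S) := pow_le_pow_left₀ (by linarith) (by linarith) _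
    have hpi := Real.pi_pos
    nlinarith

/-! ### The initial approximation -/

/-- **The best net element is within `1/200` of the target.** [cite: AharonovArad2011, §3.3] -/
theorem norm_sub_initW_le {net : List (Cand Γ)} (hnet : IsNet E net) (T : SU2)
    {score : Matrix (Fin 2) (Fin 2) K5 → ZPhiS} {κ : ℝ} (hκ : 0 < κ)
    (hscore : ∀ (a : Cand Γ) (ha : a.WF E.mat₀), κ * ZPhiS.toReal (score a.mat) =
      ((star (T : M2) * ((evS E a ha : SU2) : M2)).trace).re)
    (hW : (initW net score).WF E.mat₀) :
    ‖(T : M2) - ((evS E (initW net score) hW : SU2) : M2)‖ ≤ 1 / 200 := by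
  obtain ⟨V, hV, hVW, hTV⟩ := hnet.2 T
  have hkey := (le_toReal_key_bestBy (fun X => score X.mat) (net.headD Cand.one) net).2 V hV
  change ZPhiS.toReal (score V.mat) ≤ ZPhiS.toReal (score (initW net score).mat) at hkey
  exact (norm_sub_le_of_score_le E hκ hscore hW hVW hkey).trans hTV

/-- `initW` is well formed. [folklore] -/
theorem wf_initW {net : List (Cand Γ)} (hnet : AllWF E net) (score : Matrix (Fin 2) (Fin 2) K5 → ZPhiS) :
    (initW net score).WF E.mat₀ := by
  unfold initW
  have hd : (net.headD Cand.one).WF E.mat₀ := by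
    cases h : net with
    | nil => simpa using Cand.WF.one
    | cons x t => simpa using hnet x (by rw [h]; simp)
  rcases bestBy_mem (fun a b => ZPhiS.lt b a) (fun X => score X.mat) (net.headD Cand.one) net with h | h
  · rw [h]; exact hd
  · exact hnet _ h

/-! ### The end-to-end guarantee -/

/-- **The descent along the schedule**: after `t ≤ L` levels the error is at most `1/(200 · 4^t)`.
[cite: AharonovArad2011, §3.3] -/
theorem norm_sub_descend_le {net : List (Cand Γ)} (hnet : IsNet E net) (hne : net ≠ []) {c₀ : Cand Γ}
    (hc₀ : c₀.WF E.mat₀) (hlo₀ : 1 / 25 ≤ chord E c₀ hc₀) (hhi₀ : chord E c₀ hc₀ ≤ 3 / 50)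
    (T : SU2) {score : Matrix (Fin 2) (Fin 2) K5 → ZPhiS} {κ : ℝ} (hκ : 0 < κ)
    (hscore : ∀ (a : Cand Γ) (ha : a.WF E.mat₀), κ * ZPhiS.toReal (score a.mat) =
      ((star (T : M2) * ((evS E a ha : SU2) : M2)).trace).re)
    {L S : ℕ} (hS : Real.pi / 4 * (3 / 25 : ℝ) ^ (2 ^ S) ≤ 1 / (200 * 4 ^ (L - 1)) / 32)
    {W₀ : Cand Γ} (hW₀ : W₀.WF E.mat₀) (hTW₀ : ‖(T : M2) - ((evS E W₀ hW₀ : SU2) : M2)‖ ≤ 1 / 200) :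
    ∀ t ≤ L, ‖(T : M2) - ((evS E (descend net (tower net c₀ S) score ((List.range t).map fun t => (1, 200 * 4 ^ t, 50 ^ (2 ^ S) + 2)) W₀)
      (wf_descend E hnet.1 (allWF_tower E hnet.1 hc₀ S) score _ hW₀ t) : SU2) : M2)‖ ≤ 1 / (200 * 4 ^ t)
  | 0, _ => by simpa [descend] using hTW₀
  | t + 1, ht => by
    have ih := norm_sub_descend_le hnet hne hc₀ hlo₀ hhi₀ T hκ hscore hS hW₀ hTW₀ t (by omega)
    obtain ⟨hangs, hdeep⟩ := ang_tower_bounds E hnet hne hc₀ hlo₀ hhi₀ S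
    have htower := allWF_tower E hnet.1 hc₀ S
    -- the level `t + 1` runs at scale `e_t = 1/(200·4^t)`
    have hq : 0 < 200 * 4 ^ t := by positivity
    have hstep := norm_sub_levelStep_le E hnet htower (fun c hc hcw => ⟨(hangs c hc hcw).1, (hangs c hc hcw).2.1⟩) T hκ hscore
      (p := 1) (q := 200 * 4 ^ t) (Jmax := 50 ^ (2 ^ S) + 2) hq (by
        have : 1 ≤ 4 ^ t := Nat.one_le_pow _ _ (by norm_num)
        omega) ?_ ?_
      (wf_descend E hnet.1 htower score _ hW₀ t) (by push_cast; exact ih)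
    · rw [evS_congr E _ (wf_levelStep E hnet.1 htower score _ _ _ (wf_descend E hnet.1 htower score _ hW₀ t))
        (descend_range_succ net (tower net c₀ S) score (fun t => (1, 200 * 4 ^ t, 50 ^ (2 ^ S) + 2)) W₀ t)]
      have e : (1 : ℝ) / (200 * 4 ^ (t + 1)) = ((1 : ℕ) : ℝ) / ((200 * 4 ^ t : ℕ) : ℝ) / 4 := by push_cast; ring
      rw [e]
      exact hstep
    · -- the deepest tower element passes `smallTest` at this scale
      refine ⟨towerLast net c₀ S, (mem_tower_iff net c₀ S _).2 ⟨S, le_rfl, rfl⟩, ?_⟩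
      apply smallTest_of_ang_le E (by positivity) (by have : 1 ≤ 4 ^ t := Nat.one_le_pow _ _ (by norm_num); omega)
        (wf_towerLast E hnet.1 hc₀ S)
      have h4 : (4 : ℝ) ^ t ≤ 4 ^ (L - 1) := pow_le_pow_right₀ (by norm_num) (by omega)
      have h4' : (0 : ℝ) < 4 ^ t := by positivity
      have key : (1 : ℝ) / (200 * 4 ^ (L - 1)) / 32 ≤ 1 / (200 * 4 ^ t * 32) := by
        rw [div_div]
        exact one_div_le_one_div_of_le (by positivity) (by nlinarith)
      refine le_trans (hdeep.trans (hS.trans key)) (le_of_eq ?_)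
      push_cast
      field_simp
      ring
    · -- `Jmax` is adequate: `2e/ang ≤ e · 50^(2^S) ≤ 50^(2^S)`
      intro c hc hcw
      obtain ⟨hθ0, _, hθlow⟩ := hangs c hc hcw
      have he1 : ((1 : ℕ) : ℝ) / ((200 * 4 ^ t : ℕ) : ℝ) ≤ 1 := by
        rw [div_le_one (by positivity)]; push_cast
        have : (1 : ℝ) ≤ 4 ^ t := one_le_pow₀ (by norm_num); linarith
      have he0 : (0 : ℝ) ≤ ((1 : ℕ) : ℝ) / ((200 * 4 ^ t : ℕ) : ℝ) := by positivity
      have h50 : (0 : ℝ) < (1 / 50 : ℝ) ^ (2 ^ S) := by positivity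
      have key : 2 * (((1 : ℕ) : ℝ) / ((200 * 4 ^ t : ℕ) : ℝ)) / ang (evS E c hcw) ≤ (50 : ℝ) ^ (2 ^ S) := by
        rw [div_le_iff₀ hθ0]
        have h1 : 2 * (((1 : ℕ) : ℝ) / ((200 * 4 ^ t : ℕ) : ℝ)) ≤ 2 := by linarith
        have h2 : (50 : ℝ) ^ (2 ^ S) * (2 * (1 / 50 : ℝ) ^ (2 ^ S)) = 2 := by
          rw [← mul_assoc, mul_comm ((50 : ℝ) ^ 2 ^ S), mul_assoc, ← mul_pow]; norm_num
        calc 2 * (((1 : ℕ) : ℝ) / ((200 * 4 ^ t : ℕ) : ℝ)) ≤ 2 := h1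
          _ = (50 : ℝ) ^ (2 ^ S) * (2 * (1 / 50 : ℝ) ^ (2 ^ S)) := h2.symm
          _ ≤ (50 : ℝ) ^ (2 ^ S) * ang (evS E c hcw) := by gcongr
      push_cast at key ⊢
      linarith

/-- `compile` is well formed. [folklore] -/
theorem wf_compile {net : List (Cand Γ)} (hnet : AllWF E net) {c₀ : Cand Γ} (hc₀ : c₀.WF E.mat₀) (S : ℕ)
    (score : Matrix (Fin 2) (Fin 2) K5 → ZPhiS) (L : ℕ) :
    (compile net c₀ S score (schedule L S)).WF E.mat₀ := by
  unfold compile schedule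
  exact wf_descend E hnet (allWF_tower E hnet hc₀ S) score _ (wf_initW E hnet score) L

/-- **Correctness of the exact compiler.** Let `net` be a nonempty `1/200`-net of `SU(2)` of
well-formed candidates, `c₀` well formed with chord in `[1/25, 3/50]`, `T ∈ SU(2)` a target whose
exact score is a positive multiple of `Re tr(T† ·)`, and `S` deep enough for `L` levels
(`(π/4)(3/25)^(2^S) ≤ e_{L-1}/32`). Then the compiled word is within `1/(200 · 4^L)` of `T`.
[cite: AharonovArad2011, §3.3] -/
theorem norm_sub_compile_le {net : List (Cand Γ)} (hnet : IsNet E net) (hne : net ≠ []) {c₀ : Cand Γ}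
    (hc₀ : c₀.WF E.mat₀) (hlo₀ : 1 / 25 ≤ chord E c₀ hc₀) (hhi₀ : chord E c₀ hc₀ ≤ 3 / 50)
    (T : SU2) {score : Matrix (Fin 2) (Fin 2) K5 → ZPhiS} {κ : ℝ} (hκ : 0 < κ)
    (hscore : ∀ (a : Cand Γ) (ha : a.WF E.mat₀), κ * ZPhiS.toReal (score a.mat) =
      ((star (T : M2) * ((evS E a ha : SU2) : M2)).trace).re)
    {L S : ℕ} (hS : Real.pi / 4 * (3 / 25 : ℝ) ^ (2 ^ S) ≤ 1 / (200 * 4 ^ (L - 1)) / 32) :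
    ‖(T : M2) - ((evS E (compile net c₀ S score (schedule L S)) (wf_compile E hnet.1 hc₀ S score L) : SU2) : M2)‖ ≤
      1 / (200 * 4 ^ L) := by
  have h := norm_sub_descend_le E hnet hne hc₀ hlo₀ hhi₀ T hκ hscore hS (wf_initW E hnet.1 score)
    (norm_sub_initW_le E hnet T hκ hscore (wf_initW E hnet.1 score)) L le_rfl
  exact h

end ExactCompiler

end Literature.Computability.QuantumComplexity

end
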